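import Mathlib
import Summits.Langlands.Langlands.Theses.PicardMuOrdinary
import Summits.Langlands.Langlands.Theorems.IrregularClassicality.Negative.EmbeddingWLOG
import Literature.NumberTheory.GaloisRepresentations.CubicResidueSymbol
import Literature.NumberTheory.GaloisRepresentations.GaloisRep
import Literature.NumberTheory.GaloisRepresentations.HeckeCharacter
import Literature.NumberTheory.Automorphic.UnitaryGroupAutomorphicRep
import Literature.NumberTheory.Automorphic.MokWeakBaseChange
import Literature.NumberTheory.Automorphic.UnitaryGroupLimitOfDiscreteSeriesAt
import Literature.NumberTheory.Automorphic.AlgebraicityTwist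
import Literature.AlgebraicGeometry.Motives.PicardCurveMuOrdinaryReduction

/-!
# Line `sen-cousin-anisotropic-saddle` — checked skeleton for the crux
`Summit.Langlands.Langlands.Theses.PicardMuOrdinary.IrregularClassicality` (stmt-Langlands-13758)

Planner crux-plan, round 1, GENERATION 2 (idea card
`Cruxes/IrregularClassicality/Ideas/sen-cousin-anisotropic-saddle.md`; triage `TRIAGE-r1-{1,2,3}.md`: pass ×3 with the
instruction "merge with `sen-kills-cousin-on-p2` (same lever)"; line card `Lines/sen-cousin-anisotropic-saddle.md`).
This generation MERGES the two Sen lines at skeleton level: it keeps generation 1's automorphic pipeline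
(polarise/descend → lever by regime → base-change endgame, with its corrected odd-weight polarisation and the
`U`-versus-`GU` weight-one twist) and peels the GALOIS periphery off the lever exactly as the sibling skeleton
`Lines/sen-kills-cousin-on-p2.lean` does (triage r1-2 F3: "big image of `ρ_C` and typicity as NAMED stubs; CM corner
separately"): `stub_picardGaloisRep`, `stub_eichlerShimuraTypic`, `stub_cmCorner` are VERBATIM the sibling's stubs (same
names, same statements), so one proof closes them for both lines.

Seven registered stubs `stub_*` (each `theorem stub_X : <signature> := by sorry`, a genuine lemma of the line stated over
existing declarations plus the abbreviations of the Vocabulary section) and the kernel-checked composition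
`IrregularClassicality_of : DescendedTowerStmt → PicardGaloisRepStmt → EichlerShimuraTypicStmt →
SenCousinMuOrdinaryStmt → SenCousinBasicStmt → BaseChangeEndgameStmt → CMCornerStmt → IrregularClassicality`
(pure logic + the landed Negative lemma `irregularClassicality_iff_fixed`), with `IrregularClassicality_proof` feeding
it the seven stubs (sorries live only inside the stubs; `IrregularClassicality_of` itself has axioms
`[propext, Classical.choice, Quot.sound]`; `…_proof` certifies that each registered signature is definitionally the
named statement).

THE LINE ("Sen = Cousin at the anisotropic saddle").  `K = ℚ(ω)`, `λ = (1 − ω)`, `C : y³ = f(x)` a generic Picard curve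
over `ℚ`, `ρ_C` the `λ`-adic `G_K`-representation with geometric Frobenius traces `a_𝔭(f) = picardTrace f 𝔭`
(Hodge–Tate `{0,0,1}|{0,1,1}`, IRREGULAR; polarised with ODD multiplier `ρ_C^c ≅ ρ_C^∨ ⊗ ε⁻¹`).  The crux hands us a
`3`-adic tower of regular algebraic cuspidal `P_k` on `GL₃/K` with `N𝔭·Σ Sat(P_k,𝔭) ≡ e(a_𝔭(f)) mod 3^k` off a finite
`S`, and asks for a cuspidal L-algebraic `π` with `Σ Sat(π,𝔭) = e(a_𝔭(f))` a.e.  Route through the PICARD MODULAR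
SURFACE (Shimura variety of `U(2,1) = U_{K/ℚ}(3)`, Mok's quasi-split unitary group of the anti-diagonal form):
(T) the tower is polarised of odd weight and of bounded tame level (interface debt) and each member descends — after a
twist by ONE algebraic weight-one character `χ` of `K` and an integral power of the norm — to an automorphic `ϖ_k` of
`U(2,1)` of bounded tame level (Mok descent; Asai sign `+1` by archimedean parity), `stub_descendedTower`;
(G) the Picard Galois representation `ρ ≅ ρ_C` at the fixed embedding, `stub_picardGaloisRep`;
(N) Nekovář's abstract Eichler–Shimura ⇒ typicity for `(GL₃, std)` under big image, `stub_eichlerShimuraTypic`;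
(C) THE LEVER, by regime of `f` at `3` (`HasMuOrdinaryReductionAtThree f`), GIVEN the descended tower, `ρ`, big image
and the typicity principle: the limit eigensystem is a point of the completed Hecke algebra of `H̃²` of the perfectoid
Picard surface at that tame level, its locally analytic `𝔟 = χ_{(1,1,1)}`-isotypic part is `ρ_C ⊗ W` (typicity),
`p`-adic Eichler–Shimura filters it by the three Kostant cells `H⁰_{Id}†, H¹_{s}†, H²_{w₀}†` of `Fℓ = ℙ²`, the colliding
pair `(Gr⁰, Gr¹)` carries equal Sen scalars and the nilpotent part of Sen is `c·Cous` (`c ≠ 0`); `ρ_C` de Rham ⇒ Sen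
semisimple ⇒ the `λ_C`-part of `Gr⁰` lies in `ker Cous` = CLASSICAL cuspidal Picard modular forms of the singular
weight `(1,1,1)`, whose `ϖ_∞` is a non-degenerate limit of discrete series — NEW at the ramified prime: the length-one
Bruhat cell is ANISOTROPIC, so `H¹_s†` is a finite-slope higher-Coleman theory supported at the CM-supersingular
saddle `[e₂]`, not a μ-ordinary/higher-Hida object (triage F2, verified by all three triagers) —
`stub_senCousinMuOrdinary` (fs vector available: Pan Thm. 1.0.3 form) / `stub_senCousinBasic` (Pan Thm. 1.0.4 form:
the bet); (D) Mok ascent + cuspidality + archimedean base change + untwisting give the cuspidal L-algebraic `π`,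
`stub_baseChangeEndgame`; (M) if `ρ` fails the big-image hypothesis (CM Jacobian — e.g. the admissible `f₆₇` of
Disproof item 20, always λ-BASIC — or the `Sym²` form, vacuous by Hodge–Tate weights) the conclusion holds outright by
cubic automorphic induction, `stub_cmCorner`.

Shape (data flow of `IrregularClassicality_of`): fix an embedding `e₀` (WLOG by the landed
`Negative.EmbeddingWLOG.irregularClassicality_iff_fixed`) and a non-trivial `c ∈ Aut(K/ℚ)`; get `(ι, S₀, ρ)` from (G);
if `¬ HasBigImage ρ`, (M) concludes; else (N) gives `IsTypic ρ`,
`TowerAt ⟶[T] DescendedTowerAt ⟶[C₁ | C₂ by HasMuOrdinaryReductionAtThree f, fed ρ + HasBigImage + IsTypic]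
classical Picard form ϖ + PicardMatchAt ⟶[D] AutomorphyAt e₀`.

Normalisations (the crux's own, audited in `Disproof.lean` item 4, `automorphy_of_exactRegularMatch`): hypothesis side
`N𝔭·Σα(P_k)` (regular algebraic `P_k`), conclusion side `Σα(π)` (L-algebraic `π`).  `U(2,1)`-side objects meet
`GL₃/K`-side data ONLY through the accepted `UnitaryGroup.HasBaseChangeSatakeAt` (Mok's standard base change on
unramified classes) composed with the twist by `χ(ϖ_𝔭)·N𝔭^n` (`HeckeCharacter.valueAtUniformizer`, the tree's convention
`Sat(P ⊗ χ∘det, 𝔭) = χ(ϖ_𝔭)·Sat(P, 𝔭)` of `AutomorphicTwistBJ`), `χ` ALGEBRAIC: the base change of a `U(2,1)`-form has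
INTEGRAL infinitesimal character (`LDSDatum 2 1`: parameters in `ℤ`) and EVEN multiplier, while `ρ_C` has odd motivic
weight, so a weight-one CM character of `K` (e.g. the Grössencharacter of `y² = x³ + 1`, or the conductor-`3` character
`ψ(𝔭) = ϖ_𝔭` of the sibling lines' parity notes) must intervene — the `U` versus `GU` bookkeeping made explicit; the
three parity analyses on file (gen-1 `IsOddPolarizedAE`, `Lines/sen-kills-cousin-on-p2.md` §Parity,
`ParityNote-split-ramified-prime-sqrt6.md`) agree.  Galois side: `ρ` enters only through `FramedRep.trace ρ τ⁻¹ =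
ι.symm (e₀ (a_𝔭 f))` at arithmetic Frobenii `τ` (geometric Frobenius trace, Disproof item 16), exactly as in the sibling
skeletons of this crux and of `MuOrdinaryFamilyRT` (`stub_picardGaloisInput`).

Disproof.lean (cdisprove cycles 1–2, items 1–20, read 2026-08-16): NO `_false_without_` theorem exists (item 2: the crux
is the target plus a hypothesis), so none can be violated; honoured: items 5/9/13 (only the LIMIT is consumed — every
`P_k` enters through `Serves … k`; no stub is a stationary, recurring or finite-range instance, so the landed
`Negative/StationaryCollapse`, `Negative/FiniteRangeCollapse` refute nothing here; `Negative/NormalForm` is an `↔` we do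
not need beyond the fixed embedding), item 7 (the typed tower carries no polarisation, level or slope: the first two are
isolated as the debt half of `stub_descendedTower` with the CORRECTED clause `IsOddPolarizedAE` — odd integer weight
`∃ n`, NOT the bare weight-zero `IsConjSelfDualAE`, which is parity-false for these `P_k` — and `HasTameLevelGL`; slope
never enters), item 11 (embedding fixed via the landed `EmbeddingWLOG`, imported and used), item 12 (`S` only grows),
item 4 (the `N𝔭·Σα ↔ Σα` bookkeeping is confined to `stub_baseChangeEndgame` / `stub_cmCorner`), item 16 (one global
`V_e` with traces `ι(a_𝔭 f)` for every embedding: justifies `stub_picardGaloisRep` at the prescribed `e₀`), items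
17(c)/20 (the CM corner is NON-EMPTY inside `12 ∣ #Gal` — `f₆₇` — and λ-basic: it is `stub_cmCorner`, reached in the
composition BEFORE any regime split, so no lever stub ever sees a CM `ρ`).  Negatives index: 1 unrelated entry
(K3KugaSatakeDescent anchor).
-/

set_option linter.dupNamespace false
set_option linter.unusedVariables false

noncomputable section

open scoped NumberField Polynomial Classical
open IsDedekindDomain Filter NumberField Polynomial
open Literature.NumberTheory.GaloisRepresentations Literature.NumberTheory.Automorphic
open Literature.AlgebraicGeometry.Motives

namespace Summit.Langlands.Langlands.Cruxes.IrregularClassicality.SenCousinAnisotropicSaddle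

/-! ## Vocabulary (abbreviations of sub-clauses; everything unfolds to existing declarations) -/

/-- `K = ℚ(ω)`. -/
abbrev Kω : Type := CyclotomicField 3 ℚ

/-- Finite places of `K`. -/
abbrev Pl : Type := HeightOneSpectrum (𝓞 Kω)

/-- `ℤ̄ ⊂ ℂ`, the algebraic integers (as in the route file). -/
abbrev Zbar : Type := integralClosure ℤ ℂ

/-- The genericity hypotheses of the crux on `f`: a separable quartic with `12 ∣ #Gal(f)` (`Gal(f) ∈ {A₄, S₄}`). -/
def Generic (f : ℤ[X]) : Prop :=
  f.natDegree = 4 ∧ (f.map (Int.castRingHom ℚ)).Separable ∧ 12 ∣ Nat.card (f.map (Int.castRingHom ℚ)).Gal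

/-- **`P` serves depth `k` of the tower `(e₀, 𝔐, S)` for `f`** — the inner clause of the crux VERBATIM:
`N𝔭 · Σ Sat(P, 𝔭) ≡ e₀(a_𝔭(f)) (mod 3^k ℤ̄_𝔐)` for every `𝔭 ∉ S`. -/
def Serves (f : ℤ[X]) (hcpt : isCompact_glFiniteIntegralLevel 3 Kω) (e₀ : Kω →+* ℂ) (𝔐 : Ideal Zbar)
    (S : Finset Pl) (P : CuspidalAutomorphicRepData 3 Kω hcpt) (k : ℕ) : Prop :=
  ∀ 𝔭 ∉ S, ∃ (α : Multiset ℂ) (t u : Zbar), P.1.HasSatakeParamAt 𝔭 α ∧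
    (t : ℂ) = (𝔭.residueCard : ℂ) * α.sum - e₀ (picardTrace f 𝔭) ∧ u ∉ 𝔐 ∧
    u * t ∈ Ideal.span {(3 : Zbar) ^ k}

/-- **The typed tower** of the crux at a fixed embedding (`LimitHypothesisAt` of `Disproof.lean` with `𝔐, S`
pulled out): for every `k` a regular algebraic cuspidal `P_k` serving depth `k`. -/
def TowerAt (e₀ : Kω →+* ℂ) (f : ℤ[X]) (hcpt : isCompact_glFiniteIntegralLevel 3 Kω) (𝔐 : Ideal Zbar)
    (S : Finset Pl) : Prop :=
  ∀ k : ℕ, ∃ P : CuspidalAutomorphicRepData 3 Kω hcpt, P.1.IsRegularAlgebraic ∧ Serves f hcpt e₀ 𝔐 S P k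

/-- **Polarised of ODD integer weight `2n+1`, almost everywhere on Satake parameters**:
`Sat(P, c𝔭) = {N𝔭^{2n+1} · α_i⁻¹}` for almost all `𝔭`, i.e. `P^c ≅ P^∨ ⊗ ‖det‖^{-(2n+1)}`.  For a member
`P_k = BC(ϖ_k) ⊗ θ_k∘det` of a tower approximating `ρ_C` (`BC(ϖ_k)` conjugate self-dual, `θ_k` algebraic with
`θ_kθ_k^c` an odd power of the norm — forced 3-adically by `ρ_C^c ≅ ρ_C^∨ ⊗ ε⁻¹` and absolute irreducibility
of `ρ̄_C`: with `r = r(P_k)` normalised by geometric Frobenius eigenvalues `N𝔭·α`, `r^c ≅ r^∨ ⊗ ε^{-(2n+3)}`, so the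
congruence to `ρ_C` forces `v₃(n_k + 1) → ∞`) this holds with `n = n_k → -1` in `ℤ₃` but archimedeanly unbounded.
NOTE for the tenure planner: the bare `IsConjSelfDualAE c` (weight `0`) is parity-FALSE for such `P_k`
(three concordant analyses: this file's gen-1, `Lines/sen-kills-cousin-on-p2.md` §Parity,
`ParityNote-split-ramified-prime-sqrt6.md`). -/
def IsOddPolarizedAE (c : Kω ≃ₐ[ℚ] Kω) {hcpt : isCompact_glFiniteIntegralLevel 3 Kω}
    (P : AutomorphicRepData (AutomorphyDatum.gl 3 Kω hcpt)) (n : ℤ) : Prop :=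
  ∀ᶠ 𝔭 : Pl in cofinite, ∀ α β : Multiset ℂ, P.HasSatakeParamAt 𝔭 α → P.HasSatakeParamAt (c • 𝔭) β →
    β = α.map (fun a => (𝔭.residueCard : ℂ) ^ (2 * n + 1) * a⁻¹)

/-- **`P` has tame level `𝔫`**: a form of `P = W/W'`, non-zero modulo `W'`, fixed by the principal congruence
subgroup `K(3^m · 𝔫)` for some `m` (level at `λ ∣ 3` unrestricted, level away from `3` bounded by `𝔫`). -/
def HasTameLevelGL {hcpt : isCompact_glFiniteIntegralLevel 3 Kω} (𝔫 : Ideal (𝓞 Kω))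
    (P : AutomorphicRepData (AutomorphyDatum.gl 3 Kω hcpt)) : Prop :=
  ∃ m : ℕ, ∃ φ ∈ P.W, φ ∉ P.W' ∧
    ∀ u ∈ principalCongruenceLevel 3 Kω (Ideal.span {(3 : 𝓞 Kω)} ^ m * 𝔫),
      rightTranslation (AdelicGroupData.gl 3 Kω) u φ = φ

/-- **A polarised tower of bounded tame level**: a typed tower every member of which is polarised of some odd
weight a.e. and has tame level `𝔫` (one `𝔫 ≠ 0` for all `k`).  (Intermediate notion of the debt half of
`stub_descendedTower`; kept so that a restate of 13757/13758 can be copied from it.) -/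
def PolarizedTowerAt (c : Kω ≃ₐ[ℚ] Kω) (e₀ : Kω →+* ℂ) (f : ℤ[X])
    (hcpt : isCompact_glFiniteIntegralLevel 3 Kω) (𝔐 : Ideal Zbar) (S : Finset Pl) : Prop :=
  ∃ 𝔫 : Ideal (𝓞 Kω), 𝔫 ≠ 0 ∧ ∀ k : ℕ, ∃ (P : CuspidalAutomorphicRepData 3 Kω hcpt) (n : ℤ),
    P.1.IsRegularAlgebraic ∧ IsOddPolarizedAE c P.1 n ∧ HasTameLevelGL 𝔫 P.1 ∧ Serves f hcpt e₀ 𝔐 S P k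

/-- **`ϖ` is a descent of `P ⊗ (χ‖·‖^{-n}) ∘ det` off `T`** (Satake form of "a twist of `P` is the standard weak
base change of `ϖ`"): at every `𝔭 ∉ T`, every Satake parameter `α` of `P` at `𝔭` gives the base-change Satake
parameter `{χ(ϖ_𝔭) · N𝔭^n · α_i}` of `ϖ` at `𝔭` (accepted `UnitaryGroup.HasBaseChangeSatakeAt`, Mok's `ξ₁`
on unramified classes; `HeckeCharacter.valueAtUniformizer`, the tree's twist convention). -/
def IsDescentOf (c : Kω ≃ₐ[ℚ] Kω) {hcpt : isCompact_glFiniteIntegralLevel 3 Kω} (χ : HeckeCharacter Kω)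
    (n : ℤ) (T : Finset Pl) (P : AutomorphicRepData (AutomorphyDatum.gl 3 Kω hcpt))
    (ϖ : UnitaryGroupAutomorphicRep ℚ Kω c 3 hcpt) : Prop :=
  ∀ 𝔭 ∉ T, ∀ α : Multiset ℂ, P.HasSatakeParamAt 𝔭 α →
    UnitaryGroup.HasBaseChangeSatakeAt ℚ Kω c 3 hcpt ϖ 𝔭
      (α.map (fun a => χ.valueAtUniformizer 𝔭 * (𝔭.residueCard : ℂ) ^ n * a))

/-- **`ϖ` has tame level `𝔫`** on `U(2,1)`: a form of `ϖ`, non-zero modulo `W'`, fixed by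
`K_U(3^m · 𝔫) = U(𝔸_ℚ) ∩ K(3^m · 𝔫)` for some `m` (accepted `UnitaryGroup.level`). -/
def HasTameLevelU (c : Kω ≃ₐ[ℚ] Kω) {hcpt : isCompact_glFiniteIntegralLevel 3 Kω} (𝔫 : Ideal (𝓞 Kω))
    (ϖ : UnitaryGroupAutomorphicRep ℚ Kω c 3 hcpt) : Prop :=
  ∃ m : ℕ, ∃ φ ∈ ϖ.W, φ ∉ ϖ.W' ∧
    ∀ u ∈ UnitaryGroup.level ℚ Kω c 3 (Ideal.span {(3 : 𝓞 Kω)} ^ m * 𝔫),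
      rightTranslation (UnitaryGroup.quasiSplit ℚ Kω c 3) u φ = φ

/-- **A descended tower** — "`λ_C` (twisted by the fixed algebraic `χ`) is a `3`-adic limit of eigensystems of
the Picard modular group of tame level `𝔫`", i.e. PRO-MODULARITY ON `U(2,1)`, the input of the lever: ONE
algebraic `χ`, ONE finite `T`, ONE `𝔫 ≠ 0`, and for every `k` a regular algebraic cuspidal `P_k` serving depth
`k` together with an automorphic `ϖ_k` of `U_{K/ℚ}(3)` of tame level `𝔫` which is a descent of
`P_k ⊗ (χ‖·‖^{-n_k})∘det` off `T`. -/
def DescendedTowerAt (c : Kω ≃ₐ[ℚ] Kω) (e₀ : Kω →+* ℂ) (f : ℤ[X])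
    (hcpt : isCompact_glFiniteIntegralLevel 3 Kω) (𝔐 : Ideal Zbar) (S : Finset Pl) : Prop :=
  ∃ (χ : HeckeCharacter Kω) (T : Finset Pl) (𝔫 : Ideal (𝓞 Kω)), χ.IsAlgebraic ∧ 𝔫 ≠ 0 ∧
    ∀ k : ℕ, ∃ (P : CuspidalAutomorphicRepData 3 Kω hcpt) (ϖ : UnitaryGroupAutomorphicRep ℚ Kω c 3 hcpt)
      (n : ℤ), P.1.IsRegularAlgebraic ∧ IsDescentOf c χ n T P.1 ϖ ∧ HasTameLevelU c 𝔫 ϖ ∧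
        Serves f hcpt e₀ 𝔐 S P k

/-- **`ϖ` is a classical Picard modular cusp form of coherent type**: a CUSPIDAL automorphic representation of
`U(2,1)` whose archimedean component is a non-degenerate limit of discrete series of `U(2,1)` (accepted
`IsNondegenerateLimitOfDiscreteSeriesAt` for the anti-diagonal form, signature `(2,1)`), i.e. `ϖ` occurs in the
coherent cohomology of the Picard modular surface (Goldring–Koskivirta 2019, Thm. 2.2.1).  For the output of the
lever the datum is the singular weight-`(1,1,1)` parameter `λ = (1, 0 | 0)` with the holomorphic chamber; the
weight is deliberately not pinned (the endgame works for every non-degenerate datum). -/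
def IsClassicalPicardForm (c : Kω ≃ₐ[ℚ] Kω) (hc : c ≠ 1) (hcpt : isCompact_glFiniteIntegralLevel 3 Kω)
    (ϖ : UnitaryGroup.CuspidalAutomorphicRepData ℚ Kω c 3 hcpt) : Prop :=
  ∃ (w : {w : InfinitePlace Kω // w.IsComplex}) (hw : c • w.1 = w.1) (d : LDSDatum 2 1),
    UnitaryGroup.IsNondegenerateLimitOfDiscreteSeriesAt ℚ Kω c 3 (StdForm.antidiagonal 3) hcpt ϖ.1 hw hc d

/-- **`ϖ` is attached to the Picard curve `C_f`** (output of the lever, finite side): for some ALGEBRAIC Hecke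
character `χ'` of `K`, at almost every `𝔭` some base-change Satake parameter `β` of `ϖ` satisfies
`Σ_i χ'(ϖ_𝔭) β_i = e₀(a_𝔭(f))` — "the untwisted base change of `ϖ` has the Frobenius traces of `ρ_C`". -/
def PicardMatchAt (c : Kω ≃ₐ[ℚ] Kω) (e₀ : Kω →+* ℂ) (f : ℤ[X]) (hcpt : isCompact_glFiniteIntegralLevel 3 Kω)
    (ϖ : UnitaryGroupAutomorphicRep ℚ Kω c 3 hcpt) : Prop :=
  ∃ χ' : HeckeCharacter Kω, χ'.IsAlgebraic ∧
    ∀ᶠ 𝔭 : Pl in cofinite, ∃ β : Multiset ℂ, UnitaryGroup.HasBaseChangeSatakeAt ℚ Kω c 3 hcpt ϖ 𝔭 β ∧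
      (β.map (fun b => χ'.valueAtUniformizer 𝔭 * b)).sum = e₀ (picardTrace f 𝔭)

/-- The crux's conclusion at the fixed embedding `e₀` (`AutomorphyConclusionAt` of `Disproof.lean`, VERBATIM
the right-hand side of `Negative.EmbeddingWLOG.irregularClassicality_iff_fixed`). -/
def AutomorphyAt (e₀ : Kω →+* ℂ) (f : ℤ[X]) (hcpt : isCompact_glFiniteIntegralLevel 3 Kω) : Prop :=
  ∃ π : CuspidalAutomorphicRepData 3 Kω hcpt, π.1.IsLAlgebraic ∧
    ∀ᶠ 𝔭 : Pl in cofinite, ∃ α : Multiset ℂ, π.1.HasSatakeParamAt 𝔭 α ∧ α.sum = e₀ (picardTrace f 𝔭)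

/-- **The Picard Galois input at `e₀`** (VERBATIM the conclusion clauses of `stub_picardGaloisRep`): `S₀` contains
every place above `3`, `ρ` is absolutely irreducible, unramified off `S₀`, with GEOMETRIC Frobenius trace
`ι⁻¹(e₀(a_𝔭 f))` at `𝔭 ∉ S₀` (so `ρ ≅ ρ_C` read through `ι`, by Chebotarev + Brauer–Nesbitt). -/
def IsPicardGaloisRepAt (e₀ : Kω →+* ℂ) (f : ℤ[X]) (ι : PadicAlgCl 3 ≃+* ℂ) (S₀ : Finset Pl)
    (ρ : FramedGaloisRep Kω (PadicAlgCl 3) 3) : Prop :=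
  (∀ v : Pl, ((3 : ℕ) : 𝓞 Kω) ∈ v.asIdeal → v ∈ S₀) ∧
    FramedRep.IsAbsolutelyIrreducible ρ ∧
    ∀ 𝔭 ∉ S₀, ρ.IsUnramifiedAt 𝔭 ∧
      ∀ 𝔓 ∈ 𝔭.primesAbove, ∀ τ : Field.absoluteGaloisGroup Kω,
        IsArithFrobAt (𝓞 Kω) τ 𝔓 → FramedRep.trace ρ τ⁻¹ = ι.symm (e₀ (picardTrace f 𝔭))

/-- **Big image of `ρ`, elementary form** (VERBATIM the two hypotheses of `stub_eichlerShimuraTypic` and the negated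
clause of `stub_cmCorner`): (i) strongly irreducible (absolutely irreducible on every `Γ_L`, `L/K` finite — excludes
the induced = CM case), (ii) one element with three distinct eigenvalues in no `Sym²` relation (excludes `GO₃`); hence
Zariski closure `⊇ SL₃`.  For the non-CM Picard Jacobian this is Mumford–Tate (dimension `≤ 3`: Moonen–Zarhin). -/
def HasBigImage (ρ : FramedGaloisRep Kω (PadicAlgCl 3) 3) : Prop :=
  (∀ (L : Type) [Field L] [NumberField L] [Algebra (CyclotomicField 3 ℚ) L],
      FramedRep.IsAbsolutelyIrreducible (ρ.restrictField L)) ∧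
    ∃ (g : Field.absoluteGaloisGroup (CyclotomicField 3 ℚ)) (x y z : PadicAlgCl 3),
      FramedRep.charpoly ρ g = (X - C x) * (X - C y) * (X - C z) ∧
      x ≠ y ∧ y ≠ z ∧ x ≠ z ∧ x * z ≠ y ^ 2 ∧ x * y ≠ z ^ 2 ∧ y * z ≠ x ^ 2

/-- **The typicity principle for `ρ`** (VERBATIM the conclusion shape of `stub_eichlerShimuraTypic`, quantified over
all `(n, s, S₁)`): every continuous `s : Γ_K → GL_n(ℚ̄₃)` satisfying the EICHLER–SHIMURA RELATION with respect to `ρ`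
off a finite `S₁` (`s`, `ρ` unramified and `charpoly(ρ(Frob_𝔓))` annihilates `s(Frob_𝔓)`) is `ρ`-typic,
`s = P · diag(ρ, …, ρ) · P⁻¹`.  The lever applies it to `s = V[𝔭_C]`, the `𝔭_C`-torsion of the `𝔟`-isotypic locally
analytic completed `H²` (BCGP Lemma 276 transplanted; triage r1-2 F3). -/
def IsTypic (ρ : FramedGaloisRep Kω (PadicAlgCl 3) 3) : Prop :=
  ∀ (n : ℕ) (s : FramedGaloisRep (CyclotomicField 3 ℚ) (PadicAlgCl 3) n)
    (S₁ : Finset (HeightOneSpectrum (𝓞 (CyclotomicField 3 ℚ)))),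
    (∀ 𝔭 ∉ S₁, s.IsUnramifiedAt 𝔭 ∧ ρ.IsUnramifiedAt 𝔭 ∧
      ∀ 𝔓 ∈ 𝔭.primesAbove, ∀ τ : Field.absoluteGaloisGroup (CyclotomicField 3 ℚ),
        IsArithFrobAt (𝓞 (CyclotomicField 3 ℚ)) τ 𝔓 →
          Polynomial.aeval ((s τ : GL (Fin n) (PadicAlgCl 3)) : Matrix (Fin n) (Fin n) (PadicAlgCl 3))
            (FramedRep.charpoly ρ τ) = 0) →
    ∃ (m : ℕ) (e : Fin n ≃ Fin 3 × Fin m) (P : GL (Fin n) (PadicAlgCl 3)),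
      ∀ g : Field.absoluteGaloisGroup (CyclotomicField 3 ℚ),
        ((s g : GL (Fin n) (PadicAlgCl 3)) : Matrix (Fin n) (Fin n) (PadicAlgCl 3)) =
          (P : Matrix (Fin n) (Fin n) (PadicAlgCl 3)) *
            Matrix.reindex e.symm e.symm
              (Matrix.blockDiagonal fun _ : Fin m =>
                ((ρ g : GL (Fin 3) (PadicAlgCl 3)) : Matrix (Fin 3) (Fin 3) (PadicAlgCl 3))) *
            ((P⁻¹ : GL (Fin n) (PadicAlgCl 3)) : Matrix (Fin n) (Fin n) (PadicAlgCl 3))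

/-! ## The seven stub statements (named, so that `IrregularClassicality_of` takes them as hypotheses) -/

/-- Statement of `stub_descendedTower` (verbatim). -/
def DescendedTowerStmt : Prop :=
  ∀ (c : Kω ≃ₐ[ℚ] Kω), c ≠ 1 → ∀ (e₀ : Kω →+* ℂ) (f : ℤ[X]) (hcpt : isCompact_glFiniteIntegralLevel 3 Kω),
    Generic f →
    (∃ (𝔐 : Ideal Zbar) (S : Finset Pl), 𝔐.IsMaximal ∧ (3 : Zbar) ∈ 𝔐 ∧ TowerAt e₀ f hcpt 𝔐 S) →
    ∃ (𝔐 : Ideal Zbar) (S : Finset Pl), 𝔐.IsMaximal ∧ (3 : Zbar) ∈ 𝔐 ∧ DescendedTowerAt c e₀ f hcpt 𝔐 S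

/-- Statement of `stub_picardGaloisRep` (verbatim; identical with the sibling line `sen-kills-cousin-on-p2`). -/
def PicardGaloisRepStmt : Prop :=
  ∀ (f : ℤ[X]), f.natDegree = 4 → (f.map (Int.castRingHom ℚ)).Separable →
    12 ∣ Nat.card (f.map (Int.castRingHom ℚ)).Gal →
  ∀ (e₀ : CyclotomicField 3 ℚ →+* ℂ),
  ∃ (ι : PadicAlgCl 3 ≃+* ℂ)
    (S₀ : Finset (HeightOneSpectrum (𝓞 (CyclotomicField 3 ℚ))))
    (ρ : FramedGaloisRep (CyclotomicField 3 ℚ) (PadicAlgCl 3) 3),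
    (∀ v : HeightOneSpectrum (𝓞 (CyclotomicField 3 ℚ)),
      ((3 : ℕ) : 𝓞 (CyclotomicField 3 ℚ)) ∈ v.asIdeal → v ∈ S₀) ∧
    FramedRep.IsAbsolutelyIrreducible ρ ∧
    ∀ 𝔭 ∉ S₀, ρ.IsUnramifiedAt 𝔭 ∧
      ∀ 𝔓 ∈ 𝔭.primesAbove, ∀ τ : Field.absoluteGaloisGroup (CyclotomicField 3 ℚ),
        IsArithFrobAt (𝓞 (CyclotomicField 3 ℚ)) τ 𝔓 →
          FramedRep.trace ρ τ⁻¹ = ι.symm (e₀ (picardTrace f 𝔭))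

/-- Statement of `stub_eichlerShimuraTypic` (verbatim; identical with the sibling line `sen-kills-cousin-on-p2`). -/
def EichlerShimuraTypicStmt : Prop :=
  ∀ (S₁ : Finset (HeightOneSpectrum (𝓞 (CyclotomicField 3 ℚ))))
    (ρ : FramedGaloisRep (CyclotomicField 3 ℚ) (PadicAlgCl 3) 3)
    (n : ℕ) (s : FramedGaloisRep (CyclotomicField 3 ℚ) (PadicAlgCl 3) n),
    (∀ (L : Type) [Field L] [NumberField L] [Algebra (CyclotomicField 3 ℚ) L],
      FramedRep.IsAbsolutelyIrreducible (ρ.restrictField L)) →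
    (∃ (g : Field.absoluteGaloisGroup (CyclotomicField 3 ℚ)) (x y z : PadicAlgCl 3),
      FramedRep.charpoly ρ g = (X - C x) * (X - C y) * (X - C z) ∧
      x ≠ y ∧ y ≠ z ∧ x ≠ z ∧ x * z ≠ y ^ 2 ∧ x * y ≠ z ^ 2 ∧ y * z ≠ x ^ 2) →
    (∀ 𝔭 ∉ S₁, s.IsUnramifiedAt 𝔭 ∧ ρ.IsUnramifiedAt 𝔭 ∧
      ∀ 𝔓 ∈ 𝔭.primesAbove, ∀ τ : Field.absoluteGaloisGroup (CyclotomicField 3 ℚ),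
        IsArithFrobAt (𝓞 (CyclotomicField 3 ℚ)) τ 𝔓 →
          Polynomial.aeval ((s τ : GL (Fin n) (PadicAlgCl 3)) : Matrix (Fin n) (Fin n) (PadicAlgCl 3))
            (FramedRep.charpoly ρ τ) = 0) →
  ∃ (m : ℕ) (e : Fin n ≃ Fin 3 × Fin m) (P : GL (Fin n) (PadicAlgCl 3)),
    ∀ g : Field.absoluteGaloisGroup (CyclotomicField 3 ℚ),
      ((s g : GL (Fin n) (PadicAlgCl 3)) : Matrix (Fin n) (Fin n) (PadicAlgCl 3)) =
        (P : Matrix (Fin n) (Fin n) (PadicAlgCl 3)) *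
          Matrix.reindex e.symm e.symm
            (Matrix.blockDiagonal fun _ : Fin m =>
              ((ρ g : GL (Fin 3) (PadicAlgCl 3)) : Matrix (Fin 3) (Fin 3) (PadicAlgCl 3))) *
          ((P⁻¹ : GL (Fin n) (PadicAlgCl 3)) : Matrix (Fin n) (Fin n) (PadicAlgCl 3))

/-- Statement of `stub_senCousinMuOrdinary` (verbatim). -/
def SenCousinMuOrdinaryStmt : Prop :=
  ∀ (c : Kω ≃ₐ[ℚ] Kω) (hc : c ≠ 1) (e₀ : Kω →+* ℂ) (f : ℤ[X]) (hcpt : isCompact_glFiniteIntegralLevel 3 Kω),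
    Generic f → HasMuOrdinaryReductionAtThree f →
    ∀ (𝔐 : Ideal Zbar) (S : Finset Pl), 𝔐.IsMaximal → (3 : Zbar) ∈ 𝔐 →
      DescendedTowerAt c e₀ f hcpt 𝔐 S →
    ∀ (ι : PadicAlgCl 3 ≃+* ℂ) (S₀ : Finset Pl) (ρ : FramedGaloisRep Kω (PadicAlgCl 3) 3),
      IsPicardGaloisRepAt e₀ f ι S₀ ρ → HasBigImage ρ → IsTypic ρ →
      ∃ ϖ : UnitaryGroup.CuspidalAutomorphicRepData ℚ Kω c 3 hcpt,
        IsClassicalPicardForm c hc hcpt ϖ ∧ PicardMatchAt c e₀ f hcpt ϖ.1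

/-- Statement of `stub_senCousinBasic` (verbatim). -/
def SenCousinBasicStmt : Prop :=
  ∀ (c : Kω ≃ₐ[ℚ] Kω) (hc : c ≠ 1) (e₀ : Kω →+* ℂ) (f : ℤ[X]) (hcpt : isCompact_glFiniteIntegralLevel 3 Kω),
    Generic f → ¬ HasMuOrdinaryReductionAtThree f →
    ∀ (𝔐 : Ideal Zbar) (S : Finset Pl), 𝔐.IsMaximal → (3 : Zbar) ∈ 𝔐 →
      DescendedTowerAt c e₀ f hcpt 𝔐 S →
    ∀ (ι : PadicAlgCl 3 ≃+* ℂ) (S₀ : Finset Pl) (ρ : FramedGaloisRep Kω (PadicAlgCl 3) 3),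
      IsPicardGaloisRepAt e₀ f ι S₀ ρ → HasBigImage ρ → IsTypic ρ →
      ∃ ϖ : UnitaryGroup.CuspidalAutomorphicRepData ℚ Kω c 3 hcpt,
        IsClassicalPicardForm c hc hcpt ϖ ∧ PicardMatchAt c e₀ f hcpt ϖ.1

/-- Statement of `stub_baseChangeEndgame` (verbatim). -/
def BaseChangeEndgameStmt : Prop :=
  ∀ (c : Kω ≃ₐ[ℚ] Kω) (hc : c ≠ 1) (e₀ : Kω →+* ℂ) (f : ℤ[X]) (hcpt : isCompact_glFiniteIntegralLevel 3 Kω),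
    Generic f → ∀ ϖ : UnitaryGroup.CuspidalAutomorphicRepData ℚ Kω c 3 hcpt,
      IsClassicalPicardForm c hc hcpt ϖ → PicardMatchAt c e₀ f hcpt ϖ.1 → AutomorphyAt e₀ f hcpt

/-- Statement of `stub_cmCorner` (verbatim; identical with the sibling line `sen-kills-cousin-on-p2`). -/
def CMCornerStmt : Prop :=
  ∀ (f : ℤ[X]) (hcpt : isCompact_glFiniteIntegralLevel 3 (CyclotomicField 3 ℚ)),
    f.natDegree = 4 → (f.map (Int.castRingHom ℚ)).Separable →
    12 ∣ Nat.card (f.map (Int.castRingHom ℚ)).Gal →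
  ∀ (e₀ : CyclotomicField 3 ℚ →+* ℂ) (ι : PadicAlgCl 3 ≃+* ℂ)
    (S₀ : Finset (HeightOneSpectrum (𝓞 (CyclotomicField 3 ℚ))))
    (ρ : FramedGaloisRep (CyclotomicField 3 ℚ) (PadicAlgCl 3) 3),
    FramedRep.IsAbsolutelyIrreducible ρ →
    (∀ 𝔭 ∉ S₀, ρ.IsUnramifiedAt 𝔭 ∧
      ∀ 𝔓 ∈ 𝔭.primesAbove, ∀ τ : Field.absoluteGaloisGroup (CyclotomicField 3 ℚ),
        IsArithFrobAt (𝓞 (CyclotomicField 3 ℚ)) τ 𝔓 →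
          FramedRep.trace ρ τ⁻¹ = ι.symm (e₀ (picardTrace f 𝔭))) →
    ¬ ((∀ (L : Type) [Field L] [NumberField L] [Algebra (CyclotomicField 3 ℚ) L],
          FramedRep.IsAbsolutelyIrreducible (ρ.restrictField L)) ∧
        ∃ (g : Field.absoluteGaloisGroup (CyclotomicField 3 ℚ)) (x y z : PadicAlgCl 3),
          FramedRep.charpoly ρ g = (X - C x) * (X - C y) * (X - C z) ∧
          x ≠ y ∧ y ≠ z ∧ x ≠ z ∧ x * z ≠ y ^ 2 ∧ x * y ≠ z ^ 2 ∧ y * z ≠ x ^ 2) →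
  ∃ π : CuspidalAutomorphicRepData 3 (CyclotomicField 3 ℚ) hcpt, π.1.IsLAlgebraic ∧
    ∀ᶠ 𝔭 : HeightOneSpectrum (𝓞 (CyclotomicField 3 ℚ)) in Filter.cofinite,
      ∃ α : Multiset ℂ, π.1.HasSatakeParamAt 𝔭 α ∧ α.sum = e₀ (picardTrace f 𝔭)

/-! ## The seven stubs (registered: `theorem stub_X : <signature> := by sorry`) -/

/-- **Stub T — POLARISE, BOUND THE TAME LEVEL, AND DESCEND THE TOWER TO `U(2,1)` (interface debt + Mok descent;
the lead should spend NO cycles on the debt half before the tenure planner's restate).**  For generic `f`, `c ≠ 1`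
and a fixed `e₀`: a typed `3`-adic tower of regular algebraic cuspidal `P_k` (trace congruences off a finite `S`)
yields, possibly for another `(𝔐, S)`, a DESCENDED tower: ONE algebraic Hecke character `χ` of `K` (intended: a
weight-one CM character with `χχ^c = ‖·‖^{±1}`, e.g. the Grössencharacter of `y² = x³ + 1` / the conductor-`3`
character `ψ(𝔭) = ϖ_𝔭`, or its inverse — class number one, conductor a power of `λ`), ONE finite `T` (intended
`S ∪ {λ}`), ONE tame level `𝔫 ≠ 0`, and for every `k` the member `P_k` together with an automorphic `ϖ_k` on
`U_{K/ℚ}(3)` of tame level `𝔫` that is a descent of `P_k ⊗ (χ‖·‖^{-n_k})∘det` off `T` (`IsDescentOf`).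
Two halves.  (T.debt) POLARISATION + LEVEL: every `P_k` is polarised of some ODD weight a.e.
(`IsOddPolarizedAE c P_k n_k`) and of one tame level `𝔫₀` (`HasTameLevelGL`) — i.e. `PolarizedTowerAt`; the limit
`ρ_C` is polarised (`ρ_C^c ≅ ρ_C^∨ ⊗ ε⁻¹`: Weil pairing between the `ω`- and `ω̄`-parts of `H¹(C)`; in traces
`a_{c𝔭}(f) = c(a_𝔭(f))`) and the INTENDED towers of the sibling crux (μ-ordinary Hida / eigenvariety families on
unitary groups, base-changed and untwisted) satisfy both clauses member by member, but as an IMPLICATION from the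
bare typed tower this is a polarised-infinite-fern / `p`-adic automorphic descent statement of 13757 difficulty
(Disproof items 7, 17(a); triage F1 ×3): TRUE presumably, unprovable here; the tame-level clause alone is derivable on
paper (Swan conductors of `r(P_k) ≡ ρ_C mod 3^k` at `𝔭 ∈ S ∖ λ` equal those of `ρ̄_C`, so `a(r(P_k)_𝔭) ≤ 3 + Swan`,
then local–global compatibility at `ℓ ≠ p` for `GL₃/K`, Varma) but is better carried by the restate.  It becomes
trivial once the tenure planner re-cuts the 13757 → 13758 interface by ANY of the three concordant proposals on file —
(i) add `∃ n, IsOddPolarizedAE c P_k n` and `HasTameLevelGL 𝔫₀ P_k` (one `𝔫₀ ≠ 0` outside `∀ k`) to the `P_k`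
(this file), (ii) `IsConjSelfDualAE` for the `ψ`-TWISTED traces `a_𝔭(f)·ϖ_𝔭`
(`ParityNote-split-ramified-prime-sqrt6.md`), (iii) the tower in unitary currency
(`Lines/sen-kills-cousin-on-p2.lean`, `stub_twistedUnitaryTower`) — NOT the bare weight-zero `IsConjSelfDualAE c` on
`P_k` recommended in triage, which is parity-false; whichever is chosen should also carry a tame-level clause, or every
completed-cohomology line re-derives it from Galois conductors.  (T.descent, M on paper, L in Lean — the real
mathematics of this stub, provable NOW as a helper `--supports` lemma in the shape of gen-1's `UnitaryDescentStmt`: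
"∃ χ algebraic, ∀ S 𝔫₀ ≠ 0, ∃ T 𝔫 ≠ 0, every regular algebraic cuspidal `P`, unramified off `S`, of tame level `𝔫₀`,
odd-polarised a.e., has `ϖ` of tame level `𝔫` with `IsDescentOf c χ n' T P ϖ`"): with `χ_tot := χ·‖·‖^{n'}`, `n'`
solving `χ_totχ_tot^c = ‖·‖^{2n+1}`, the twist `P' := P ⊗ χ_tot∘det` is cuspidal, conjugate self-dual a.e.
(`χ_tot(ϖ_{c𝔭})·N𝔭^{2n+1}α⁻¹ = (χ_tot(ϖ_𝔭)α)⁻¹`), hence everywhere (strong multiplicity one), unitary, with INTEGRAL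
infinitesimal character; PARITY LEMMA: a conjugate self-dual cuspidal `Π` on `GL_N/K`, `N` odd, with integral
infinitesimal character at the complex place is conjugate-ORTHOGONAL (its parameter at `∞` contains a `c`-fixed
character `(z/|z|)^{2a}`, `a ∈ ℤ`, of sign `(-1)^{2a} = +1`, while a conjugate-symplectic `Π` is conjugate-symplectic at
every place — Gan–Gross–Prasad, Mok Thm. 2.5.4/Cor. 2.5.7), so in Mok's classification its sign is `κ = +1`,
`L^S(s, Π, As⁺)` has a pole (`HasAsaiSign c 1`; dichotomy `Mok2014_partialAsaiL_pole_dichotomy` in tree), and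
`Mok2014_standardBaseChange_descent` (named fact, in tree) gives `ϖ` with `IsWeakBaseChange P' ϖ`; Mok's local–global
compatibility (Thm. 2.5.1/3.2.1) upgrades a.e. to every `𝔭 ∉ T` and bounds the tame level of `ϖ` by that of `P'`.
Lean-side work: twisting a Borel–Jacquet datum by a NON-finite-order algebraic character (`AutomorphicTwistBJ` treats
finite order, `AutomorphicTwistNorm` norm powers) and its Satake rule; existence of `χ` (`HeckeCharacterArchExistence`);
cite items for the Asai parity and the strong form of Mok's base change.  Why it might fail (descent half): only through
conventions (direction of `c •` on places, the exponent `2n+1` versus `-(2n+1)`, the sign in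
`HeckeCharacter.HasInfinityType`) — absorbed by the existential `n'` and the free choice of `χ`. -/
theorem stub_descendedTower :
    ∀ (c : Kω ≃ₐ[ℚ] Kω), c ≠ 1 → ∀ (e₀ : Kω →+* ℂ) (f : ℤ[X]) (hcpt : isCompact_glFiniteIntegralLevel 3 Kω),
      Generic f →
      (∃ (𝔐 : Ideal Zbar) (S : Finset Pl), 𝔐.IsMaximal ∧ (3 : Zbar) ∈ 𝔐 ∧ TowerAt e₀ f hcpt 𝔐 S) →
      ∃ (𝔐 : Ideal Zbar) (S : Finset Pl), 𝔐.IsMaximal ∧ (3 : Zbar) ∈ 𝔐 ∧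
        DescendedTowerAt c e₀ f hcpt 𝔐 S := by
  sorry

/-- **Stub G — THE PICARD GALOIS REPRESENTATION AT A PRESCRIBED EMBEDDING (L; SHARED VERBATIM with
`Lines/sen-kills-cousin-on-p2.lean` `stub_picardGaloisRep` and, up to fixing the embedding, with the sibling crux's
`Cruxes/MuOrdinaryFamilyRT/Lines/weight-blind-lambda-adic-rt.lean` `stub_picardGaloisInput`).**  For a separable
quartic `f ∈ ℤ[X]` with `12 ∣ #Gal(f)` and EVERY embedding `e₀ : K → ℂ` there are a field isomorphism `ι : ℚ̄₃ ≃ ℂ`,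
a finite set `S₀` of finite places of `K` containing every place above `3`, and a continuous
`ρ : Γ_K → GL₃(ℚ̄₃)` (intended: the `ω`-eigenpart `V_{e₀}` of the `3`-adic `H¹_ét` of `C : y³ = f(x)`, read through
`ι`) which is absolutely irreducible (its reduction is the reflection representation of `Gal(f) ∈ {A₄, S₄}` on
`𝔽₃⁴/diag`, Poonen–Schaefer / Upton), unramified at every `𝔭 ∉ S₀`, with GEOMETRIC Frobenius trace
`ι⁻¹(e₀(a_𝔭(f)))` at `𝔭 ∉ S₀` (twisted Lefschetz on the `ω`-eigenpart, Disproof item 16: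
`tr(F_q^* | H¹[ū^* = ι(ω)]) = ι(a_𝔭 f)` for EVERY embedding, so prescribing `e₀` is harmless — or replace `ι` by
`ι ∘ conj`).  The lever re-derives from THIS datum (not from the limit of the `r(P_k)`) that `ρ` is de Rham at `λ`
with Hodge–Tate type `((1,1,0),(1,0,0))` — the one input that kills the nilpotent Sen operator; de Rham-ness is not
exported here because the tree's `IsDeRhamFramed` is relative to a posited `PstWeilDeligneData`.  Size L (Tate module
of the Picard Jacobian absent from Mathlib; tree: `SuperellipticTorsionRep`, `CubicResidueSymbol`,
`PadicAlgCl.nonempty_ringEquiv_complex`). -/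
theorem stub_picardGaloisRep :
    ∀ (f : ℤ[X]), f.natDegree = 4 → (f.map (Int.castRingHom ℚ)).Separable →
      12 ∣ Nat.card (f.map (Int.castRingHom ℚ)).Gal →
    ∀ (e₀ : CyclotomicField 3 ℚ →+* ℂ),
    ∃ (ι : PadicAlgCl 3 ≃+* ℂ)
      (S₀ : Finset (HeightOneSpectrum (𝓞 (CyclotomicField 3 ℚ))))
      (ρ : FramedGaloisRep (CyclotomicField 3 ℚ) (PadicAlgCl 3) 3),
      (∀ v : HeightOneSpectrum (𝓞 (CyclotomicField 3 ℚ)),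
        ((3 : ℕ) : 𝓞 (CyclotomicField 3 ℚ)) ∈ v.asIdeal → v ∈ S₀) ∧
      FramedRep.IsAbsolutelyIrreducible ρ ∧
      ∀ 𝔭 ∉ S₀, ρ.IsUnramifiedAt 𝔭 ∧
        ∀ 𝔓 ∈ 𝔭.primesAbove, ∀ τ : Field.absoluteGaloisGroup (CyclotomicField 3 ℚ),
          IsArithFrobAt (𝓞 (CyclotomicField 3 ℚ)) τ 𝔓 →
            FramedRep.trace ρ τ⁻¹ = ι.symm (e₀ (picardTrace f 𝔭)) := by
  sorry

/-- **Stub N — EICHLER–SHIMURA RELATION ⇒ TYPICITY (Nekovář; BCGP 2025 Prop. 272 for `(GL₃, std)`; L; SHARED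
VERBATIM with `Lines/sen-kills-cousin-on-p2.lean` `stub_eichlerShimuraTypic`).**  Let `ρ : Γ_K → GL₃(ℚ̄₃)` be
continuous with BIG IMAGE in the elementary form (i) `ρ` is absolutely irreducible on `Γ_L` for every finite
extension `L/K` (strong irreducibility: excludes the induced = CM case) and (ii) some `ρ(g)` has three pairwise
distinct eigenvalues `x, y, z` satisfying no relation `xz = y²`, `xy = z²`, `yz = x²` (excludes an image in `GO₃`,
i.e. the `Sym²` form) — so the Zariski closure of `ρ(Γ_K)` contains `SL₃`, its `ℚ̄₃`-Lie algebra contains `𝔰𝔩₃`, and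
the standard representation is minuscule.  Let `s : Γ_K → GL_n(ℚ̄₃)` be continuous and suppose the EICHLER–SHIMURA
RELATION off a finite `S₁`: `s`, `ρ` unramified at `𝔭` and `charpoly(ρ(Frob_𝔓))(s(Frob_𝔓)) = 0` for every arithmetic
Frobenius.  Then `s ≅ ρ^{⊕ m}`: `n = 3m` and `s = P · diag(ρ, …, ρ) · P⁻¹`.  Proof in print: Nekovář, *Eichler–Shimura
relations and semisimplicity of étale cohomology of quaternionic Shimura varieties*, Ann. Sci. ÉNS 51 (2018),
abstract part (3), as applied in BCGP arXiv:2502.20645 Prop. 272 / Lemma 276 (pp. 77–79): hypothesis (C') from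
Chebotarev (Frobenii off `S₁` are dense), (A') from the Lie algebra computation; semisimplicity of `s` because a generic
element of `ρ(Γ_K)` is regular semisimple.  Why it is a stub of THIS line (triage r1-2 (a)/F3): "typicity from the
congruence relation" is a `GL₂` phenomenon; for `n = 3` the `λ_C`-part of completed cohomology is identified with
`ρ_C ⊗ W` only through this principle, which the lever consumes as the hypothesis `IsTypic ρ`.  Size L (Chebotarev
density facts exist in the tree; compact subgroups of `GL_n(ℚ̄₃)` lie in `GL_n(E)`, `E/ℚ₃` finite; `p`-adic Lie theory à
la Nekovář §§3–4 is NOT in the tree). -/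
theorem stub_eichlerShimuraTypic :
    ∀ (S₁ : Finset (HeightOneSpectrum (𝓞 (CyclotomicField 3 ℚ))))
      (ρ : FramedGaloisRep (CyclotomicField 3 ℚ) (PadicAlgCl 3) 3)
      (n : ℕ) (s : FramedGaloisRep (CyclotomicField 3 ℚ) (PadicAlgCl 3) n),
      (∀ (L : Type) [Field L] [NumberField L] [Algebra (CyclotomicField 3 ℚ) L],
        FramedRep.IsAbsolutelyIrreducible (ρ.restrictField L)) →
      (∃ (g : Field.absoluteGaloisGroup (CyclotomicField 3 ℚ)) (x y z : PadicAlgCl 3),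
        FramedRep.charpoly ρ g = (X - C x) * (X - C y) * (X - C z) ∧
        x ≠ y ∧ y ≠ z ∧ x ≠ z ∧ x * z ≠ y ^ 2 ∧ x * y ≠ z ^ 2 ∧ y * z ≠ x ^ 2) →
      (∀ 𝔭 ∉ S₁, s.IsUnramifiedAt 𝔭 ∧ ρ.IsUnramifiedAt 𝔭 ∧
        ∀ 𝔓 ∈ 𝔭.primesAbove, ∀ τ : Field.absoluteGaloisGroup (CyclotomicField 3 ℚ),
          IsArithFrobAt (𝓞 (CyclotomicField 3 ℚ)) τ 𝔓 →
            Polynomial.aeval ((s τ : GL (Fin n) (PadicAlgCl 3)) : Matrix (Fin n) (Fin n) (PadicAlgCl 3))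
              (FramedRep.charpoly ρ τ) = 0) →
    ∃ (m : ℕ) (e : Fin n ≃ Fin 3 × Fin m) (P : GL (Fin n) (PadicAlgCl 3)),
      ∀ g : Field.absoluteGaloisGroup (CyclotomicField 3 ℚ),
        ((s g : GL (Fin n) (PadicAlgCl 3)) : Matrix (Fin n) (Fin n) (PadicAlgCl 3)) =
          (P : Matrix (Fin n) (Fin n) (PadicAlgCl 3)) *
            Matrix.reindex e.symm e.symm
              (Matrix.blockDiagonal fun _ : Fin m =>
                ((ρ g : GL (Fin 3) (PadicAlgCl 3)) : Matrix (Fin 3) (Fin 3) (PadicAlgCl 3))) *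
            ((P⁻¹ : GL (Fin n) (PadicAlgCl 3)) : Matrix (Fin n) (Fin n) (PadicAlgCl 3)) := by
  sorry

/-- **Stub C₁ — THE LEVER, μ-ORDINARY REGIME (hardest; K1 + K2-occurrence + K3a of the card): SEN = COUSIN AT THE
ANISOTROPIC SADDLE ⇒ a pro-modular irregular eigensystem on the Picard surface is classical, GIVEN the Galois input,
big image and the typicity principle.**  For generic `f` with μ-ordinary (3-rank-2, λ-distinguished, potentially good)
reduction at `3` — the regime of the towers the sibling crux will actually deliver, and automatically non-CM
(Disproof item 20(b)/triage F6: CM Picard Jacobians are λ-basic) — a DESCENDED tower (one algebraic `χ`, one `T`, one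
tame level `𝔫`) converging to `e₀(a_𝔭(f))`, the Picard Galois representation `ρ` at `e₀` (`IsPicardGaloisRepAt`), its
big image (`HasBigImage`, supplied by the composition) and the typicity principle `IsTypic ρ` (from Stub N) yield a
CUSPIDAL automorphic `ϖ` of `U(2,1)` which is a non-degenerate limit of discrete series at `∞` (a classical coherent
cusp form of the Picard modular surface, singular weight `(1,1,1)`) attached to `C_f` (`PicardMatchAt`).
Internal plan (objects NOT in the tree — they live inside this proof; the typed home of (K2-point) once a `U(2,1)`
split-prime Hecke dictionary exists is `CompletedCohomology.IsHeckePoint` / `EigensystemOccurs` over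
`ArithmeticQuotient.cohomology` of the Picard arithmetic group — a reshape the lead may request): (K2-point) the `ϖ_k`
are cohomological (archimedean base change: the infinitesimal character of `ϖ_{k,∞}` is the regular integral one of
`P_k ⊗ χ_tot`), their eigensystems occur in `H²` of the Picard surface of tame level `𝔫` with algebraic local systems,
hence in completed `H̃²` with trivial coefficients (Emerton/Scholze), and the twisted eigensystems CONVERGE 3-adically
(the norm exponents `n_k` converge in `ℤ₃` to an INTEGER because the polarisation weights do — `v₃(n_k+1) → ∞` — and
`N𝔭 ≡ 1 mod 3` for every `𝔭 ∤ 3` of `K`, so no Teichmüller sign appears), so the limit `λ_C^χ` is a point `𝔭_C` of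
the big Hecke algebra `𝕋(K^p)_𝔪` (`𝔪 = 𝔪_{ρ̄_C ⊗ χ̄}` non-Eisenstein) of `H̃²` at tame level `𝔫` and infinite level
at `λ`, with Galois representation `ρ ⊗ χ_gal·ε^{n_∞}`; (K2-typic) on
`V = H²(RHom_𝔟(χ_{(1,1,1)}, RΓ(𝒮_{K^p}, ℚ̄₃)^{la}))_𝔪` occurrence + finiteness give a finite-dimensional `Γ_K`-stable
`s = V[𝔭_C] ≠ 0` satisfying the Eichler–Shimura relation w.r.t. `ρ` (congruence relation for `GU(2,1)`, Koskivirta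
2014 / Bültel–Wedhorn; BCGP Thm. "ESRFC" shape in completed cohomology), so `IsTypic ρ` makes it `ρ^{⊕m}` —
OCCURRENCE is where this regime is easier: the μ-ordinary members supply a `U_λ`-finite vector in
`Gr⁰ = H⁰_{Id}†` (Pan Thm. 1.0.3 form; card point 6 for `Gr⁰` only), so the `ModPLanglandsGL2BeyondQp` barrier
(Colmez–Kirillov behind Pan's Thm. 1.0.4) is NOT met here, while finiteness of `Gr¹[𝔭_C]` must come from finite-slope
theory at the BASIC saddle (below), not from a `T(ℚ₃)`-ordinary projector (triage r1-1 (b));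
(K1) `p`-adic Eichler–Shimura for `RHom_𝔟(χ_{(1,1,1)}, RΓ(𝒮_{K^p}, ℚ₃)^{la})` on the perfectoid Picard surface
(`π_HT : 𝒮_{K^p} → ℙ²`, Scholze; geometric Sen theory, Rodríguez Camargo arXiv:2205.02016/2209.01057; BCGP25 §4 "Hodge
type, `G_{ℚ_p}` quasi-split", p. 48 — ramified `U(2,1)(ℚ₃)` IS quasi-split): graded pieces `H⁰_{Id}†` (overconvergent
`H⁰` at the isotropic attractor `[e₁]`, containing the μ-ordinary forms), `H¹_{s}†` (finite-slope higher Coleman `H¹` of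
Boxer–Pilloni type on a tube of the ANISOTROPIC length-one cell `{[x e₁ + e₂]}` around the `T(ℚ₃)`-fixed saddle `[e₂]`,
whose `π_HT`-fibre is basic — triage F2: over `𝔽₉` the 28 isotropic lines sit `1/0/27` in cells `0/1/2`), `H²_{w₀}†`;
Sen scalars `(0,0,1)` on the three cells; the nilpotent part of Sen `Gr⁰ → Gr¹` equals `c·Cous`, `c ≠ 0` (BCGP25
Thm. "ext-equal"/271: a `D`-module identity on `Fℓ` seeing only `(GL₃, P_{(2,1)})` — `𝔲_{(2,1)}` abelian, `λ`
algebraic hence non-Liouville; contracting dynamics from the regular element `diag(3,1,1/3)` of the rank-one torus);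
(K3a) `ρ` de Rham at `λ` (it IS the Tate module of the Picard Jacobian, by its traces: Chebotarev + Brauer–Nesbitt) ⇒
Sen semisimple on `ρ^{⊕m} = V[𝔭_C]` ⇒ `Cous = 0` on the `𝔭_C`-part of `Gr⁰` ⇒ a non-zero class in
`ker(Cous | H⁰_{Id}†[𝔭_C]) = e·H⁰(𝒮^{tor}, ω^{(1,1,1)}(−D))[𝔭_C]` (Boxer–Pilloni: the Cousin bicomplex computes
classical coherent cohomology, here at parahoric-or-deeper level at the ramified prime over the Pappas–Rapoport/Krämer
model; compactly supported variant if the boundary clause fails for the Picard cusps) — a classical cuspidal Picard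
eigenform; for the local lemma "μ-ordinary 3-step shape over `K_λ`: de Rham ⟺ Sen semisimple" one has
`dim H¹(K_λ, η) = 2`, `dim H¹_g(η) = 1` for `η` of Hodge–Tate type `(0,1)` (card P2, triage ✓); Pan's parity step needs
only "multiplicity `≢ 0 mod 3`" (Fourier–Jacobi multiplicity `≤ 2`), not multiplicity one; its `ϖ` is cuspidal with
`ϖ_∞ = π((1,0|0), Ψ_hol)`, a non-degenerate limit of discrete series (`IsClassicalPicardForm`), and its base change is
`ρ_C`'s eigensystem twisted by the algebraic `χ·‖·‖^{n_∞}` (`PicardMatchAt` with `χ' = (χ‖·‖^{n_∞})⁻¹`).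
WHY IT MIGHT FAIL: "𝔟-cohomology concentrated / Sen = Cousin" is in print only for ORDINARY parts with `p` split
(BCGP25 Thm. thm-ECpadic, arXiv:2502.20645 p. 4: other cases "will require new ideas"); here `Gr¹` has NO ordinary
incarnation (anisotropic cell) and every comparison with classical coherent cohomology at the ramified prime runs
through models with reducible special fibre (BijakowskiHernandez2023AR Thm. 1.1); and the level at `λ` is never
spherical (`f₃(C) ≥ 4`, `≥ 6` potentially good — triage F4), harmless at infinite level but felt in every finite-level
comparison.  Size XL (the open theorem). -/
theorem stub_senCousinMuOrdinary :
    ∀ (c : Kω ≃ₐ[ℚ] Kω) (hc : c ≠ 1) (e₀ : Kω →+* ℂ) (f : ℤ[X])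
      (hcpt : isCompact_glFiniteIntegralLevel 3 Kω),
      Generic f → HasMuOrdinaryReductionAtThree f →
      ∀ (𝔐 : Ideal Zbar) (S : Finset Pl), 𝔐.IsMaximal → (3 : Zbar) ∈ 𝔐 →
        DescendedTowerAt c e₀ f hcpt 𝔐 S →
      ∀ (ι : PadicAlgCl 3 ≃+* ℂ) (S₀ : Finset Pl) (ρ : FramedGaloisRep Kω (PadicAlgCl 3) 3),
        IsPicardGaloisRepAt e₀ f ι S₀ ρ → HasBigImage ρ → IsTypic ρ →
        ∃ ϖ : UnitaryGroup.CuspidalAutomorphicRepData ℚ Kω c 3 hcpt,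
          IsClassicalPicardForm c hc hcpt ϖ ∧ PicardMatchAt c e₀ f hcpt ϖ.1 := by
  sorry

/-- **Stub C₂ — THE LEVER OUTSIDE THE μ-ORDINARY REGIME, NON-CM (the BET; lowest priority).**  Same statement for
generic `f` WITHOUT μ-ordinary reduction at `3` (λ-supersingular `y³ − y = x⁴` type, non-distinguished, or not
potentially good: `ρ_C|G_{K_λ}` in the basic locus or non-trianguline with non-abelian wild inertia, BouwEtAl2020),
still with big image (the CM corner never reaches this stub: the composition sends `¬ HasBigImage` to `stub_cmCorner`).
Same mechanism — infinite level at `λ` sees these members (no Iwahori eigenvariety does) and the Sen = Cousin identity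
is slope-free at `H⁰` — but two inputs change: (i) OCCURRENCE, the non-vanishing of the `𝔭_C`-part of the locally
analytic vectors of the right `𝔟`-character in `Gr⁰`, can no longer lean on a `U_λ`-finite vector (Pan's Thm. 1.0.4
form; for `GL₂(ℚ_p)` this is Emerton's local–global compatibility + Colmez's Kirillov model — the
`ModPLanglandsGL2BeyondQp` barrier BITES here: the honest bet of the card; Kirillov-free alternatives named by the
sibling: finite-slope theory at the basic saddle, admissibility + Dospinescu–Paškūnas–Schraen infinitesimal
character); (ii) the local `p`-adic Hodge theory is of Pan-II type (`B_dR`-comparison rather than "de Rham ⟺ Sen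
semisimple").  No tower of this regime is expected from the sibling crux's current lines (all concede
`RTSupersingular`), so this stub is moot for the route's progress until one appears; it is recorded so that the skeleton
concludes the crux BY NAME for every generic `f`, and as the place where the claim "slope-free at `H⁰`" is cashed or
refuted.  Size XL (bet). -/
theorem stub_senCousinBasic :
    ∀ (c : Kω ≃ₐ[ℚ] Kω) (hc : c ≠ 1) (e₀ : Kω →+* ℂ) (f : ℤ[X])
      (hcpt : isCompact_glFiniteIntegralLevel 3 Kω),
      Generic f → ¬ HasMuOrdinaryReductionAtThree f →
      ∀ (𝔐 : Ideal Zbar) (S : Finset Pl), 𝔐.IsMaximal → (3 : Zbar) ∈ 𝔐 →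
        DescendedTowerAt c e₀ f hcpt 𝔐 S →
      ∀ (ι : PadicAlgCl 3 ≃+* ℂ) (S₀ : Finset Pl) (ρ : FramedGaloisRep Kω (PadicAlgCl 3) 3),
        IsPicardGaloisRepAt e₀ f ι S₀ ρ → HasBigImage ρ → IsTypic ρ →
        ∃ ϖ : UnitaryGroup.CuspidalAutomorphicRepData ℚ Kω c 3 hcpt,
          IsClassicalPicardForm c hc hcpt ϖ ∧ PicardMatchAt c e₀ f hcpt ϖ.1 := by
  sorry

/-- **Stub D — BASE-CHANGE ENDGAME (M on paper, L in Lean; K3b of the card).**  For generic `f`: a cuspidal `ϖ` on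
`U(2,1)`, non-degenerate limit of discrete series at `∞`, attached to `C_f` (`PicardMatchAt` with an algebraic `χ'`)
gives the crux's conclusion at `e₀`: a CUSPIDAL, L-ALGEBRAIC `π` on `GL₃/K` with `Σ Sat(π, 𝔭) = e₀(a_𝔭(f))` a.e.
Proof plan: Mok ascent (`Mok2014_weakBaseChange`, named fact in tree) gives an automorphic `Π₀` of `GL₃(𝔸_K)`,
conjugate self-dual, with `IsWeakBaseChange Π₀ ϖ`, so `Sat(Π₀, 𝔭) = β` for the `β` of `PicardMatchAt` at almost every
`𝔭` (Satake uniqueness, `hasSatakeParamAt_unique_holds`); CUSPIDALITY of the parameter: otherwise `Π₀` is a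
non-trivial isobaric sum, `ϖ` is endoscopic (from `U(1) × U(2)` or `U(1)³`) and the Galois (pseudo-)representation
attached to the coherent LDS form `ϖ` (Goldring–Koskivirta 2019, Thm. 10.5.x; for the Picard surface
Rogawski/Blasius–Rogawski; the `U(2)`-piece of a weight-`(1,1,1)` endoscopic packet is of weight-one type,
Deligne–Serre) is reducible, while `Σ χ'(ϖ_𝔭)β = e₀(a_𝔭(f))` a.e. forces (Chebotarev + Brauer–Nesbitt mod `3`) its
reduction to contain the absolutely irreducible reflection representation `ρ̄_C` of `A₄/S₄` (`12 ∣ #Gal f`) —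
contradiction; so a CUSPIDAL datum `Π₁` with `Sat(Π₁) = Sat(Π₀)` a.e. exists, and `π := Π₁ ⊗ χ'∘det` (cuspidal twist by
an ALGEBRAIC, infinite-order character — API shared with Stub T; Satake `χ'(ϖ_𝔭)·β`, the tree's twist rule) has
`Σ Sat(π, 𝔭) = e₀(a_𝔭(f))` a.e.; L-ALGEBRAICITY: `Π₁,∞` has the infinitesimal character `d.infChar` of `ϖ_∞`
(archimedean compatibility of Mok's base change — NOT part of the vendored `Mok2014_weakBaseChange`; a cite item),
which is integral (`LDSDatum.exists_eq_of_mem_infChar`, `(p+q−1)/2 = 1`), so `Π₁` is L-algebraic (= C-algebraic for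
`n = 3`, `isCAlgebraic_iff_isLAlgebraic_three` landed in `Negative/StationaryCollapse`) and so is its twist by the
integral-type `χ'`.  Honours Disproof item 4 (the only place where the `N𝔭·Σα ↔ Σα` bookkeeping and the odd weight
enter) and item 11 (fixed `e₀`).  Identical with the sibling's (b.vi) + `stub_untwist`. -/
theorem stub_baseChangeEndgame :
    ∀ (c : Kω ≃ₐ[ℚ] Kω) (hc : c ≠ 1) (e₀ : Kω →+* ℂ) (f : ℤ[X])
      (hcpt : isCompact_glFiniteIntegralLevel 3 Kω),
      Generic f → ∀ ϖ : UnitaryGroup.CuspidalAutomorphicRepData ℚ Kω c 3 hcpt,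
        IsClassicalPicardForm c hc hcpt ϖ → PicardMatchAt c e₀ f hcpt ϖ.1 → AutomorphyAt e₀ f hcpt := by
  sorry

/-- **Stub M — THE COMPLEMENT OF THE BIG-IMAGE CASE (CM corner; L; SHARED VERBATIM with
`Lines/sen-kills-cousin-on-p2.lean` `stub_cmCorner`; Disproof items 17(c), 20).**  If the Picard representation `ρ`
of Stub G (absolutely irreducible, geometric Frobenius traces `ι⁻¹ e₀(a_𝔭 f)`, hence `ρ ≅ ρ_C`) FAILS the big-image
hypothesis of Stub N, the conclusion of the crux holds at `e₀` outright — no tower, no Shimura variety.  Two cases.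
(1) `ρ|Γ_L` reducible for some finite `L/K`: an absolutely irreducible representation of prime dimension `3` that is
reducible on an open normal subgroup is isotypic there (excluded: `ρ_C` is Hodge–Tate with weights `{0,0,1}`, not a
twist of an Artin representation) or INDUCED, `ρ ≅ Ind_{Γ_M}^{Γ_K} θ` with `M/K` cubic and `θ` a geometric, hence
algebraic (Weil/Serre), Hecke character of `M` — the CM-Jacobian corner, NON-EMPTY in the admissible class (`f₆₇`,
`Gal = A₄`, CM by `ℚ(ω)·K₀(67)`, Disproof item 20); then `Π := AI_{M/K}(θ) ⊗ (unitary normalisation)` is cuspidal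
(irreducibility) L-algebraic automorphic on `GL₃(𝔸_K)` with `ΣSat = e₀(a_𝔭 f)` (cyclic `M/K`: Arthur–Clozel;
non-normal cubic: JPSS 1981, the tree's `automorphicInduction_unitaryCharacter_cubic`).  (2) `ρ` strongly irreducible
but EVERY `ρ(g)` has a repeated eigenvalue or a relation `xz = y²`: the Zariski closure lies in `GO₃`, so on an open
subgroup `ρ ≅ Sym² σ ⊗ η`, whose Hodge–Tate weights `{2a+c, a+b+c, 2b+c}` can repeat only if all three coincide —
impossible for `{0,0,1}`; vacuous.  Size L (Clifford theory + Hodge–Tate weights of the Picard Tate module + cubic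
automorphic induction with Satake bookkeeping). -/
theorem stub_cmCorner :
    ∀ (f : ℤ[X]) (hcpt : isCompact_glFiniteIntegralLevel 3 (CyclotomicField 3 ℚ)),
      f.natDegree = 4 → (f.map (Int.castRingHom ℚ)).Separable →
      12 ∣ Nat.card (f.map (Int.castRingHom ℚ)).Gal →
    ∀ (e₀ : CyclotomicField 3 ℚ →+* ℂ) (ι : PadicAlgCl 3 ≃+* ℂ)
      (S₀ : Finset (HeightOneSpectrum (𝓞 (CyclotomicField 3 ℚ))))
      (ρ : FramedGaloisRep (CyclotomicField 3 ℚ) (PadicAlgCl 3) 3),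
      FramedRep.IsAbsolutelyIrreducible ρ →
      (∀ 𝔭 ∉ S₀, ρ.IsUnramifiedAt 𝔭 ∧
        ∀ 𝔓 ∈ 𝔭.primesAbove, ∀ τ : Field.absoluteGaloisGroup (CyclotomicField 3 ℚ),
          IsArithFrobAt (𝓞 (CyclotomicField 3 ℚ)) τ 𝔓 →
            FramedRep.trace ρ τ⁻¹ = ι.symm (e₀ (picardTrace f 𝔭))) →
      ¬ ((∀ (L : Type) [Field L] [NumberField L] [Algebra (CyclotomicField 3 ℚ) L],
            FramedRep.IsAbsolutelyIrreducible (ρ.restrictField L)) ∧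
          ∃ (g : Field.absoluteGaloisGroup (CyclotomicField 3 ℚ)) (x y z : PadicAlgCl 3),
            FramedRep.charpoly ρ g = (X - C x) * (X - C y) * (X - C z) ∧
            x ≠ y ∧ y ≠ z ∧ x ≠ z ∧ x * z ≠ y ^ 2 ∧ x * y ≠ z ^ 2 ∧ y * z ≠ x ^ 2) →
    ∃ π : CuspidalAutomorphicRepData 3 (CyclotomicField 3 ℚ) hcpt, π.1.IsLAlgebraic ∧
      ∀ᶠ 𝔭 : HeightOneSpectrum (𝓞 (CyclotomicField 3 ℚ)) in Filter.cofinite,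
        ∃ α : Multiset ℂ, π.1.HasSatakeParamAt 𝔭 α ∧ α.sum = e₀ (picardTrace f 𝔭) := by
  sorry

/-! ## Inside Stub T: debt ∘ descent (kernel-checked factorisation, NOT registered stubs)

The two halves of `stub_descendedTower` as named statements, and the proof that they compose to it.  `PolarizeTowerStmt`
is the interface debt (trivial after the restate); `UnitaryDescentStmt` is generation 1's Stub B verbatim — the lead may
land it NOW as a helper (`--supports`) and close `stub_descendedTower` by `descendedTowerStmt_of` the day the restate lands. -/

/-- **Debt half of Stub T** (gen-1's `stub_polarizedTower`, verbatim): typed tower ⇒ polarised tower of bounded tame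
level, possibly for another `(𝔐, S)`. -/
def PolarizeTowerStmt : Prop :=
  ∀ (c : Kω ≃ₐ[ℚ] Kω), c ≠ 1 → ∀ (e₀ : Kω →+* ℂ) (f : ℤ[X]) (hcpt : isCompact_glFiniteIntegralLevel 3 Kω),
    Generic f →
    (∃ (𝔐 : Ideal Zbar) (S : Finset Pl), 𝔐.IsMaximal ∧ (3 : Zbar) ∈ 𝔐 ∧ TowerAt e₀ f hcpt 𝔐 S) →
    ∃ (𝔐 : Ideal Zbar) (S : Finset Pl), 𝔐.IsMaximal ∧ (3 : Zbar) ∈ 𝔐 ∧ PolarizedTowerAt c e₀ f hcpt 𝔐 S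

/-- **Descent half of Stub T** (gen-1's `stub_unitaryDescent`, verbatim; M on paper, L in Lean, provable now): ONE
algebraic Hecke character `χ` of `K` such that for all `S`, `𝔫₀ ≠ 0` there are a finite `T` and `𝔫 ≠ 0` with: every
regular algebraic cuspidal `P` on `GL₃/K`, unramified off `S`, of tame level `𝔫₀`, polarised of odd weight `2n+1`
a.e., has an automorphic `ϖ` on `U_{K/ℚ}(3)` of tame level `𝔫` with `IsDescentOf c χ n' T P ϖ` (parity lemma + Mok
descent, see the docstring of `stub_descendedTower`). -/
def UnitaryDescentStmt : Prop :=
  ∀ (c : Kω ≃ₐ[ℚ] Kω), c ≠ 1 → ∀ (hcpt : isCompact_glFiniteIntegralLevel 3 Kω),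
    ∃ χ : HeckeCharacter Kω, χ.IsAlgebraic ∧
      ∀ (S : Finset Pl) (𝔫 : Ideal (𝓞 Kω)), 𝔫 ≠ 0 →
        ∃ (T : Finset Pl) (𝔫' : Ideal (𝓞 Kω)), 𝔫' ≠ 0 ∧
          ∀ (P : CuspidalAutomorphicRepData 3 Kω hcpt) (n : ℤ),
            P.1.IsRegularAlgebraic → IsOddPolarizedAE c P.1 n → HasTameLevelGL 𝔫 P.1 →
            (∀ 𝔭 ∉ S, P.1.IsUnramifiedAt 𝔭) →
            ∃ (ϖ : UnitaryGroupAutomorphicRep ℚ Kω c 3 hcpt) (n' : ℤ),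
              IsDescentOf c χ n' T P.1 ϖ ∧ HasTameLevelU c 𝔫' ϖ

/-- **Stub T = debt ∘ descent** (pure logic): polarise and bound the tame level (debt), then descend member by member
with the ONE character `χ`, exceptional set `T` and tame level `𝔫'` delivered by the descent half — unramifiedness of
`P_k` outside `S` is read off `Serves`. [folklore] -/
theorem descendedTowerStmt_of (hA : PolarizeTowerStmt) (hB : UnitaryDescentStmt) : DescendedTowerStmt := by
  intro c hc e₀ f hcpt hgen htow
  obtain ⟨𝔐, S, h𝔐, h3, 𝔫, h𝔫, hpol⟩ := hA c hc e₀ f hcpt hgen htow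
  obtain ⟨χ, hχ, hBχ⟩ := hB c hc hcpt
  obtain ⟨T, 𝔫', h𝔫', hBT⟩ := hBχ S 𝔫 h𝔫
  refine ⟨𝔐, S, h𝔐, h3, χ, T, 𝔫', hχ, h𝔫', fun k => ?_⟩
  obtain ⟨P, n, hreg, hpolP, hlev, hs⟩ := hpol k
  have hunr : ∀ 𝔭 ∉ S, P.1.IsUnramifiedAt 𝔭 := fun 𝔭 h𝔭 => by
    obtain ⟨α, t, u, hα, -, -, -⟩ := hs 𝔭 h𝔭
    exact ⟨α, hα⟩
  obtain ⟨ϖ, n', hdes, hlevU⟩ := hBT P n hreg hpolP hlev hunr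
  exact ⟨P, ϖ, n', hreg, hdes, hlevU, hs⟩

/-! ## The composition: the seven stubs imply the crux, by name -/

/-- `K = ℚ(ω)` is a cyclotomic extension of `ℚ` (registered for `IsGalois`). -/
instance instIsCyclotomicKω : IsCyclotomicExtension {3} ℚ Kω :=
  CyclotomicField.isCyclotomicExtension 3 ℚ

/-- `K/ℚ` is Galois. -/
instance instIsGaloisKω : IsGalois ℚ Kω := IsCyclotomicExtension.isGalois {3} ℚ Kω

/-- `Aut(K/ℚ)` has a non-trivial element (complex conjugation): `#Aut = [K : ℚ] = φ(3) = 2`. [folklore] -/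
theorem exists_aut_ne_one : ∃ c : Kω ≃ₐ[ℚ] Kω, c ≠ 1 := by
  have hcard : Nat.card (Kω ≃ₐ[ℚ] Kω) = 2 := by
    rw [IsGalois.card_aut_eq_finrank]
    have h := IsCyclotomicExtension.Rat.finrank 3 Kω
    rw [Nat.totient_prime Nat.prime_three] at h
    convert h using 2
  haveI : Nontrivial (Kω ≃ₐ[ℚ] Kω) := by
    rw [← Finite.one_lt_card_iff_nontrivial, hcard]
    norm_num
  exact exists_ne (1 : Kω ≃ₐ[ℚ] Kω)

/-- `ℚ(ω)` has a complex embedding. [folklore] -/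
theorem nonempty_embedding : Nonempty (Kω →+* ℂ) := by
  rw [← Fintype.card_pos_iff, NumberField.Embeddings.card]
  exact Module.finrank_pos

/-- **The line concludes the crux.**  `DescendedTowerStmt → PicardGaloisRepStmt → EichlerShimuraTypicStmt →
SenCousinMuOrdinaryStmt → SenCousinBasicStmt → BaseChangeEndgameStmt → CMCornerStmt → IrregularClassicality`,
kernel-checked (no `sorry`): fix an embedding `e₀` and the normal form of the landed
`Negative.EmbeddingWLOG.irregularClassicality_iff_fixed`, fix a non-trivial `c ∈ Aut(K/ℚ)`; take the Picard Galois
representation at `e₀` (G); if it fails the big-image test, the CM corner (M) concludes outright; otherwise (N)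
specialised to `ρ` is the typicity principle, the typed tower is descended (T), the lever runs in the regime of `f`
(C₁/C₂) fed with `ρ`, its big image and typicity, and the endgame (D) turns the classical Picard form into the
fixed-embedding conclusion of the crux, literally. -/
theorem IrregularClassicality_of (hT : DescendedTowerStmt) (hG : PicardGaloisRepStmt)
    (hN : EichlerShimuraTypicStmt) (hC₁ : SenCousinMuOrdinaryStmt) (hC₂ : SenCousinBasicStmt)
    (hD : BaseChangeEndgameStmt) (hM : CMCornerStmt) :
    Summit.Langlands.Langlands.Theses.PicardMuOrdinary.IrregularClassicality := by
  obtain ⟨c, hc⟩ := exists_aut_ne_one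
  obtain ⟨e₀⟩ := nonempty_embedding
  rw [Summit.Langlands.Langlands.Theorems.IrregularClassicality.Negative.irregularClassicality_iff_fixed e₀]
  intro f hcpt hdeg hsep hgal hlim
  have hgen : Generic f := ⟨hdeg, hsep, hgal⟩
  -- (G) the Picard Galois representation at the embedding e₀
  obtain ⟨ι, S₀, ρ, hS₀, hirr, htr⟩ := hG f hdeg hsep hgal e₀
  -- the CM / small-image corner is settled outright by (M)
  by_cases hbig : HasBigImage ρ
  swap
  · exact hM f hcpt hdeg hsep hgal e₀ ι S₀ ρ hirr htr hbig
  -- (N) the typicity principle for ρ, from its big image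
  have htyp : IsTypic ρ := by
    obtain ⟨hstrong, hreg⟩ := hbig
    intro n s S₁ hES
    exact hN S₁ ρ n s hstrong hreg hES
  have hgal' : IsPicardGaloisRepAt e₀ f ι S₀ ρ := ⟨hS₀, hirr, htr⟩
  -- the typed tower, read through the Vocabulary
  have htow : ∃ (𝔐 : Ideal Zbar) (S : Finset Pl), 𝔐.IsMaximal ∧ (3 : Zbar) ∈ 𝔐 ∧ TowerAt e₀ f hcpt 𝔐 S := by
    obtain ⟨𝔐, S, h𝔐, h3, hk⟩ := hlim
    exact ⟨𝔐, S, h𝔐, h3, hk⟩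
  -- (T) polarise, bound the tame level, descend member by member
  obtain ⟨𝔐, S, h𝔐, h3, hdesc⟩ := hT c hc e₀ f hcpt hgen htow
  -- (C) the lever, by regime, fed the Galois input, big image and typicity
  obtain ⟨ϖ, hcl, hmatch⟩ : ∃ ϖ : UnitaryGroup.CuspidalAutomorphicRepData ℚ Kω c 3 hcpt,
      IsClassicalPicardForm c hc hcpt ϖ ∧ PicardMatchAt c e₀ f hcpt ϖ.1 := by
    by_cases hμ : HasMuOrdinaryReductionAtThree f
    · exact hC₁ c hc e₀ f hcpt hgen hμ 𝔐 S h𝔐 h3 hdesc ι S₀ ρ hgal' hbig htyp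
    · exact hC₂ c hc e₀ f hcpt hgen hμ 𝔐 S h𝔐 h3 hdesc ι S₀ ρ hgal' hbig htyp
  -- (D) endgame
  exact hD c hc e₀ f hcpt hgen ϖ hcl hmatch

/-- The crux from the seven stubs (sorries live only inside `stub_*`; this also certifies that each registered
signature is definitionally the corresponding named statement). -/
theorem IrregularClassicality_proof :
    Summit.Langlands.Langlands.Theses.PicardMuOrdinary.IrregularClassicality :=
  IrregularClassicality_of stub_descendedTower stub_picardGaloisRep stub_eichlerShimuraTypic
    stub_senCousinMuOrdinary stub_senCousinBasic stub_baseChangeEndgame stub_cmCorner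

end Summit.Langlands.Langlands.Cruxes.IrregularClassicality.SenCousinAnisotropicSaddle

end
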